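import Summits.HodgeConjecture.HodgeConjecture.Theorems.K2E3NormalizedCharBddNearCentralOfLieBound   -- ★ p855282 (this seat): central composition modulo the covering
import Summits.HodgeConjecture.HodgeConjecture.Theorems.K2E3CayleySliceCoversNhdsCentral           -- ★ p855283 (K2E1b-p15): the central Cayley covering `cayleySliceCoversNhdsCentral`
import HarnessLib

/-!
# K2 · E3 ∕ U12-d — socket #12 at a CENTRAL point ⟸ the pure Lie-algebra bound ALONE (the central Cayley covering is now ★)

HCML Track B «K2-LIT», cell `pub/hodgecm-mathlib`, crux H413 = `stmt-HodgeConjecture-24833` (`--supports … --as helper`), seat `hodgecm-mathlib-K2E3-p12` (g0),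
socket #12 `sig_K2E3NormalizedCharBddNearSemisimple`.  ★ p855282 `normalizedCharBddNear_central_of_lieBound` reduced the socket at a central `s` (matrix `z·1`) to
(i) a Lie-algebra bound along the Cayley slice and (ii) the central Cayley covering; (ii) is ★ p855283 `K2E3CayleySliceCoversNhdsCentral.cayleySliceCoversNhdsCentral`
(K2E1b-p15 (g0), dealt from this seat's rung list).  THIS FILE discharges (ii): **`normalizedCharBddNear_central_of_lieBound'`** — at a central point the conclusion
of `sig_K2E3NormalizedCharBddNearSemisimple` follows from the SINGLE remaining hypothesis
  «`∃ V ∈ 𝓝 0, ∃ B, ∀ y, ∀ Y ∈ V` skew, commuting with `s`, `1 ± Y` units, `y = s·(1+Y)(1−Y)⁻¹` ⟹ `√√(Π_w |disc(χ_Y)_w|_w)·‖Θ y‖ ≤ B`»,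
i.e. Harish-Chandra's Thm 16.2 + Cor 6.2 ON THE LIE ALGEBRA `𝔲_N(H) ⊗ L⁺_v` ITSELF, with the weight `|η(Y)|^{1∕2} = |disc(χ_Y)|_{L⁺_v}^{1∕2}` and no group-side
bookkeeping left [HarishChandra1999 Thm. 16.2∕16.3 p. 77, Cor. 6.2 p. 45, §17].  THEOREMS ONLY; no `sorry`; axioms ⊆ the trio.  HONEST LABEL: HC_CM is proved only
modulo the 7 printed citations (2 remaining named inputs: hLiu418 = stmt-HodgeConjecture-24832, h413 = stmt-HodgeConjecture-24833) until rung 0 closes; the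
Lie-algebra bound is NOT proved here (XXL core of the sub-line).

## References
* [HarishChandra1999AdmissibleDistributions] Harish-Chandra (DeBacker–Sally), *Admissible Invariant Distributions on Reductive p-adic Groups* (1999): Thm. 16.2∕16.3 p. 77, Cor. 6.2 p. 45, §17, §21 p. 87.
* [Rogawski1990] J. D. Rogawski, *Automorphic Representations of Unitary Groups in Three Variables* (1990), §12.7 p. 193.
-/

set_option autoImplicit false
set_option linter.dupNamespace false

noncomputable section

open NumberField IsDedekindDomain MeasureTheory Filter Topology Polynomial
open scoped Matrix MatrixGroups NNReal
open Literature.NumberTheory.Rogawski1990 Literature.NumberTheory.Automorphic Literature.NumberTheory.Automorphic.UnitaryGroup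
open Literature.NumberTheory.GaloisRepresentations Literature.NumberTheory.GaloisRepresentations.IsNonarchimedeanLocalField
open Summit.HodgeConjecture.HodgeConjecture.Cruxes.H413.K2E3NormalizedCharBddNearCentralOfLieBound
open Summit.HodgeConjecture.HodgeConjecture.Cruxes.H413.K2E3CayleySliceCoversNhdsCentral

namespace Summit.HodgeConjecture.HodgeConjecture.Cruxes.H413.K2E3NormalizedCharBddNearCentral

set_option maxHeartbeats 1600000 in
/-- **Socket #12 at a CENTRAL point from the Lie-algebra bound alone** (★ p855282 ∘ ★ p855283).
[cite: HarishChandra1999AdmissibleDistributions, Thm. 16.3 p. 77; §17; §21 p. 87] [cite: Rogawski1990, §12.7 p. 193] -/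
theorem normalizedCharBddNear_central_of_lieBound'
    (L : Type) [Field L] [NumberField L] [IsCMField L] (N : ℕ) (H : Matrix (Fin N) (Fin N) L)
    (v : HeightOneSpectrum (𝓞 ↥(maximalRealSubfield L)))
    [MeasurableSpace ((UnitaryGroup.cmDatum L N H).Local v)] [BorelSpace ((UnitaryGroup.cmDatum L N H).Local v)] (μ : Measure ((UnitaryGroup.cmDatum L N H).Local v)) [μ.IsHaarMeasure]
    (c : IrrClass ((UnitaryGroup.cmDatum L N H).Local v)) (Θ : (UnitaryGroup.cmDatum L N H).Local v → ℂ)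
    (hloc : ∀ x : (UnitaryGroup.cmDatum L N H).Local v, IsRegularElt (x.val : GL (Fin N) (UnitaryGroup.LocalRing L v)) → ∀ᶠ y in 𝓝 x, Θ y = Θ x)
    (hrep : ∀ φ : (UnitaryGroup.cmDatum L N H).Local v → ℂ, IsLocSmooth φ → c.smoothTrace μ φ = ∫ x, φ x * Θ x ∂μ)
    (s : (UnitaryGroup.cmDatum L N H).Local v) (z : (UnitaryGroup.LocalRing L v)ˣ) (hz : ((s.val : GL (Fin N) (UnitaryGroup.LocalRing L v)).val : Matrix (Fin N) (Fin N) (UnitaryGroup.LocalRing L v)) = (z : UnitaryGroup.LocalRing L v) • (1 : Matrix (Fin N) (Fin N) (UnitaryGroup.LocalRing L v)))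
    (hLie : ∃ V : Set (Matrix (Fin N) (Fin N) (UnitaryGroup.LocalRing L v)), V ∈ 𝓝 (0 : Matrix (Fin N) (Fin N) (UnitaryGroup.LocalRing L v)) ∧ ∃ B : ℝ, ∀ y : (UnitaryGroup.cmDatum L N H).Local v, ∀ Y ∈ V,
        (Y.map (UnitaryGroup.conjLocal L (IsCMField.complexConj L) v))ᵀ * ((UnitaryGroup.adelicForm L N H).map (UnitaryGroup.adeleToLocal L v)) = -(((UnitaryGroup.adelicForm L N H).map (UnitaryGroup.adeleToLocal L v)) * Y) →
        ((s.val : GL (Fin N) (UnitaryGroup.LocalRing L v)).val : Matrix (Fin N) (Fin N) (UnitaryGroup.LocalRing L v)) * Y = Y * ((s.val : GL (Fin N) (UnitaryGroup.LocalRing L v)).val : Matrix (Fin N) (Fin N) (UnitaryGroup.LocalRing L v)) → IsUnit (1 - Y) → IsUnit (1 + Y) →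
        ((y.val : GL (Fin N) (UnitaryGroup.LocalRing L v)).val : Matrix (Fin N) (Fin N) (UnitaryGroup.LocalRing L v)) = ((s.val : GL (Fin N) (UnitaryGroup.LocalRing L v)).val : Matrix (Fin N) (Fin N) (UnitaryGroup.LocalRing L v)) * ((1 + Y) * (1 - Y)⁻¹) →
        ((NNReal.sqrt (NNReal.sqrt (∏ w : PlacesOver L v, normAbs (w.1.adicCompletion L) ((Y.charpoly.discr) w))) : ℝ≥0) : ℝ) * ‖Θ y‖ ≤ B) :
    ∃ U : Set ((UnitaryGroup.cmDatum L N H).Local v), IsOpen U ∧ s ∈ U ∧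
      ∃ B : ℝ, ∀ g ∈ U, ∀ u : (UnitaryGroup.LocalRing L v)ˣ,
        (u : UnitaryGroup.LocalRing L v) *
            (((g.val : GL (Fin N) (UnitaryGroup.LocalRing L v)) : Matrix (Fin N) (Fin N) (UnitaryGroup.LocalRing L v)).det) ^ (N - 1) =
          (((g.val : GL (Fin N) (UnitaryGroup.LocalRing L v)) : Matrix (Fin N) (Fin N) (UnitaryGroup.LocalRing L v)).charpoly).discr →
        ((NNReal.sqrt (NNReal.sqrt (unitModulusChar (UnitaryGroup.LocalRing L v) u)) : ℝ≥0) : ℝ) * ‖Θ g‖ ≤ B :=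
  normalizedCharBddNear_central_of_lieBound L N H v μ c Θ hloc hrep s z hz hLie (cayleySliceCoversNhdsCentral L N H v s z hz)

end Summit.HodgeConjecture.HodgeConjecture.Cruxes.H413.K2E3NormalizedCharBddNearCentral

end
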